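import Literature.AnabelianGeometry.SemiGraphs.ThetaRayDeepFixedProjectionGeneral
import Literature.AnabelianGeometry.SemiGraphs.TemperedEscapeOfNonVerticial
import HarnessLib

/-!
# Distinct anchor-free maximal compact subgroups of `π₁^temp(𝒢_θ)` meet trivially: [SemiAnbd] Thm 3.7 (iv)
# clause 2 HOLDS at `𝒢_θ` for anchor-free pairs (typed-form audit, row «B9-GENERAL-PAIR», final assembly)

Mochizuki, *Semi-graphs of anabelioids*, Publ. RIMS **42** (2006), §3, Theorem 3.7 (iv) p. 41 ("the maximal
compact subgroups … are precisely the verticial subgroups; the intersection of two distinct maximal compact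
subgroups is either trivial or an edge-like subgroup") [cite: MochizukiSemiAnbd2006, Thm 3.7(iv) p.41].

PROOF-ONLY file (abc-iut cell, layer L3, seat abc-iut-L3-d4 gen 7; row «B9-GENERAL-PAIR@𝒢_θ» (L3-lead γ61);
frontier / erratum-grade label — typed-form audit of the cell's ∀-countable typing of Thm 3.7 (iv) (F-1750
`MaximalCompactIffVerticial`) at the countermodel `𝒢_θ(p,n)`, OUTSIDE the [IUTchIII] Cor. 3.12 cone; 0
definitions, no named fact).  Clause 1 of the typing FAILS at `𝒢_θ` (abc-iut-w6-d120 p443103: anchor-free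
maximal compacts exist); clause 2 «two distinct maximal compacts meeting non-trivially meet in an edge-like
subgroup» was known there for ANCHORED pairs (abc-iut-w6-d062 p449612) and for pairs through the escaping
procyclic `C` (abc-iut-L3-d4 gen 5 p480916).  This file settles the remaining ANCHOR-FREE pairs:

* `thetaRayFreeProP_maximalCompact_eq_of_anchorFree_of_inf_ne_bot` — **at `𝒢_θ(p,n)` (every schedule
  `n_k → ∞`), two MAXIMAL COMPACT subgroups of the canonical `π₁^temp`, one of them anchor-free (meeting every
  verticial subgroup trivially), with non-trivial intersection are EQUAL.**  Route: both are non-verticial; a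
  common `g ≠ 1`; the fixed points of `K₂` and of `closure⟨g⟩` ESCAPE (`thetaRay_height_unbounded_of_…`,
  p496504); an initial frame of `(g, K₁)` at every deep level from a `K₁`-fixed far branch (two `K₁`-fixed
  vertices of different heights, `exists_coframe_of_forall_branchMap_eq`); by the general (♦)
  (`thetaRayFreeProP_deepFixed_proj_fixed_gen`) two deep `K₂`-fixed vertices of different heights project to two
  `K₁ ∪ K₂`-fixed vertices of `𝔾̃_{n₀}`, whose first separating branch is fixed by `K₁ ∪ K₂`, so that
  `ρ_{n₀}(K₁ ∪ K₂)` lies in ONE finite cyclic branch stabiliser (Rmk 2.2.1, abc-iut-L3-d3/d4); hence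
  `closure(K₁ ⊔ K₂)` has finite level images, is COMPACT (abc-iut-L3-t9's criterion
  `isCompact_of_isClosed_of_forall_finite_image`), and maximality gives `K₁ = closure(K₁ ⊔ K₂) = K₂`.

So the typed clause 2 of Thm 3.7 (iv) holds at `𝒢_θ` for every pair with an anchor-free member (vacuously: such
pairs do not meet); with p449612 for anchored pairs the clause holds at `𝒢_θ` in full.  Nothing of [SemiAnbd]
is asserted; nothing bears on [IUTchIII] Cor. 3.12; a theorem at OUR carrier `𝒢_θ` ≠ a claim about print's
finite `𝔾`; typed ≠ proved.
-/

noncomputable section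

namespace Literature.AnabelianGeometry.SemiGraphs

open CategoryTheory Filter Topology Multiplicative
open ProfiniteSemiGraph ProfiniteSemiGraph.GaloisLevelData
open Literature.AnabelianGeometry.SemiGraphs.FreeProPRankTwo

namespace ProfiniteSemiGraph

variable (p : ℕ) [hp : Fact p.Prime] (n : ℕ → ℕ)

/-- `Thm37Hypotheses 𝒢_θ(p, n)` (re-assembled as in the parent files). [cite: MochizukiSemiAnbd2006, Thm 3.7 p.40] -/
private theorem thm37θg : (thetaRayFreeProP p n).Thm37Hypotheses :=
  thetaRayFreeProP_thm37Hypotheses p n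
    (thetaRayFreeProP_isGaloisCountable p (α p) (α_ofAdd_one p) (fun m => θHom p m)
      (fun m => (θ p m).bijective) n)
    (thetaRayFreeProP_isQuasiCoherent p (α p) (α_ofAdd_one p) (fun m => θHom p m)
      (fun m => (θ p m).bijective) n)
    (thetaRayFreeProP_isTotallyElevated_concrete p n)
    (thetaRayFreeProP_isTotallyAloof_concrete p n)
    (thetaRayFreeProP_isTotallyEstranged_concrete p n)

/-! ### The general pair -/

/-- **TWO MAXIMAL COMPACT SUBGROUPS OF `π₁^temp(𝒢_θ(p,n))`, ONE OF THEM ANCHOR-FREE, WITH NON-TRIVIAL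
INTERSECTION ARE EQUAL** (see the module docstring) — the typed clause 2 of [SemiAnbd] Thm 3.7 (iv) at the
countermodel `𝒢_θ` for anchor-free pairs, every schedule `n_k → ∞`. [cite: MochizukiSemiAnbd2006, Thm 3.7(iv) p.41] -/
theorem thetaRayFreeProP_maximalCompact_eq_of_anchorFree_of_inf_ne_bot (hn : Tendsto n atTop atTop)
    (h36 : (thetaRayFreeProP p n).Prop36Hypotheses)
    (K₁ K₂ : Subgroup ((thetaRayFreeProP p n).temperedPiChart h36).G)
    (hK₁ : IsMaximalCompactSubgroup K₁) (hK₂ : IsMaximalCompactSubgroup K₂)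
    (hfree : ∀ (v : ℕ) (H : Subgroup ((thetaRayFreeProP p n).temperedPiChart h36).G),
      H ∈ verticialSubgroups ((thetaRayFreeProP p n).temperedPiChart h36) v → K₁ ⊓ H = ⊥)
    (hne : K₁ ⊓ K₂ ≠ ⊥) : K₁ = K₂ := by
  classical
  haveI : NeZero p := ⟨hp.out.ne_zero⟩
  have h37 : (thetaRayFreeProP p n).Thm37Hypotheses := thm37θg p n
  let Dg : GaloisLevelData (thetaRayFreeProP p n) := (thetaRayFreeProP p n).galoisLevelData h36
  have hc := h36.isCountable
  let Vd := verticialLevelData_temperedPiChart (h36 := h36)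
  have hcover := Dg.cover_sameComponent hc
  have htrans := Dg.cover_htrans hc
  haveI : T2Space ((thetaRayFreeProP p n).temperedPiChart h36).G :=
    ((thetaRayFreeProP p n).temperedPiChart h36).t2Space
  obtain ⟨hK₁c, hK₁max⟩ := hK₁
  obtain ⟨hK₂c, hK₂max⟩ := hK₂
  -- both lie in no verticial subgroup
  have hK₁nv : ∀ (v : ℕ) (H : Subgroup ((thetaRayFreeProP p n).temperedPiChart h36).G),
      H ∈ verticialSubgroups ((thetaRayFreeProP p n).temperedPiChart h36) v → ¬ K₁ ≤ H := by
    intro v H hH hle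
    apply hne
    have h1 : K₁ = ⊥ := by rw [← inf_eq_left.mpr hle]; exact hfree v H hH
    rw [h1, bot_inf_eq]
  have hK₂nv : ∀ (v : ℕ) (H : Subgroup ((thetaRayFreeProP p n).temperedPiChart h36).G),
      H ∈ verticialSubgroups ((thetaRayFreeProP p n).temperedPiChart h36) v → ¬ K₂ ≤ H := by
    intro v H hH hle
    apply hne
    have h1 : H = K₂ := hK₂max H (isCompact_of_mem_verticialSubgroups _ hH) hle
    rw [← h1]
    exact hfree v H hH
  -- a common nontrivial element `g`
  obtain ⟨g, hg, hg1⟩ : ∃ g ∈ K₁ ⊓ K₂, g ≠ 1 := by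
    by_contra hno
    push Not at hno
    exact hne ((Subgroup.eq_bot_iff_forall _).mpr hno)
  have hgK₁ : g ∈ K₁ := (Subgroup.mem_inf.mp hg).1
  have hgK₂ : g ∈ K₂ := (Subgroup.mem_inf.mp hg).2
  -- `ρ_N(g) ≠ 1` from some level `j₁` on
  obtain ⟨j₁, hj₁⟩ : ∃ j₁ : ℕ, ∀ N, j₁ ≤ N → Dg.proj hc N g ≠ 1 := by
    by_contra hno
    push Not at hno
    apply hg1
    refine (Dg.system hc).eq_one_of_forall_proj g fun i => ?_
    obtain ⟨N, hiN, hN⟩ := hno i.down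
    change Dg.proj hc i.down g = 1
    rw [← Dg.mapLE_proj hc hiN g, hN, map_one]
  -- the closed procyclic subgroup of `g`: compact, non-verticial, with the same fixed vertices as `g`
  set Cg : Subgroup ((thetaRayFreeProP p n).temperedPiChart h36).G := (Subgroup.zpowers g).topologicalClosure
    with hCg
  have hCgK₁ : Cg ≤ K₁ :=
    Subgroup.topologicalClosure_minimal _ ((Subgroup.zpowers_le).mpr hgK₁) hK₁c.isClosed
  have hCgc : IsCompact (Cg : Set ((thetaRayFreeProP p n).temperedPiChart h36).G) :=
    hK₁c.of_isClosed_subset (Subgroup.isClosed_topologicalClosure _) hCgK₁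
  have hCgnv : ∀ (v : ℕ) (H : Subgroup ((thetaRayFreeProP p n).temperedPiChart h36).G),
      H ∈ verticialSubgroups ((thetaRayFreeProP p n).temperedPiChart h36) v → ¬ Cg ≤ H := by
    intro v H hH hle
    have hgH : g ∈ H := hle (Subgroup.le_topologicalClosure _ (Subgroup.mem_zpowers g))
    have h1 : g ∈ K₁ ⊓ H := Subgroup.mem_inf.mpr ⟨hgK₁, hgH⟩
    rw [hfree v H hH] at h1
    exact hg1 ((Subgroup.mem_bot).mp h1)
  have hCgfix : ∀ (N : ℕ) (y : (Dg.tree N).Vertex), (Dg.treeAct hc N g).hom.vertexMap y = y →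
      ∀ x ∈ Cg, (Dg.treeAct hc N x).hom.vertexMap y = y := fun N y hy =>
    (thetaRayFreeProP p n).treeAct_vertexMap_eq_of_mem_closure_zpowers h36 g N y hy
  -- ESCAPE (p496504) for the non-verticial compact subgroups `K₂` and `Cg`, monotone in the level
  have hesc : ∀ (C : Subgroup ((thetaRayFreeProP p n).temperedPiChart h36).G),
      IsCompact (C : Set ((thetaRayFreeProP p n).temperedPiChart h36).G) →
      (∀ (v : ℕ) (H : Subgroup ((thetaRayFreeProP p n).temperedPiChart h36).G),
        H ∈ verticialSubgroups ((thetaRayFreeProP p n).temperedPiChart h36) v → ¬ C ≤ H) →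
      ∀ B : ℕ, ∃ j : ℕ, ∀ N, j ≤ N → ∀ y : (Dg.tree N).Vertex,
        (∀ x ∈ C, (Dg.treeAct hc N x).hom.vertexMap y = y) → B ≤ (Dg.treeProj N).vertexMap y := by
    intro C hCc hCnv B
    obtain ⟨j, hj⟩ := thetaRay_height_unbounded_of_forall_not_le_verticial (G := Grp p)
      (E := Multiplicative ℤ_[p]) (up := α p) (low := fun k => θα p (n k)) h37 C hCc hCnv B
    exact ⟨j, (thetaRayFreeProP p n).height_le_of_le_level h36 (fun v : ℕ => v)
      (C : Set ((thetaRayFreeProP p n).temperedPiChart h36).G) (j := j) (B := B) hj⟩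
  have hesc₂ := hesc K₂ hK₂c hK₂nv
  have hescg : ∀ B : ℕ, ∃ j : ℕ, ∀ N, j ≤ N → ∀ y : (Dg.tree N).Vertex,
      (Dg.treeAct hc N g).hom.vertexMap y = y → B ≤ (Dg.treeProj N).vertexMap y := by
    intro B
    obtain ⟨j, hj⟩ := hesc Cg hCgc hCgnv B
    exact ⟨j, fun N hN y hy => hj N hN y (hCgfix N y hy)⟩
  have hesc₁ := hesc K₁ hK₁c hK₁nv
  have hfixV := (thetaRayFreeProP p n).exists_forall_treeAct_vertexMap_eq_of_isCompact h36
  have hprojfix := (thetaRayFreeProP p n).treeTrans_fixed_and_over h36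
  -- the far branch orders (yardstick `c`)
  obtain ⟨Nc, hNc⟩ := thetaRayFreeProP_exists_far_orderOf_eq p n hn h36
  -- KEY: at every level `n₀ ≥ j₁`, `ρ_{n₀}(K₁ ∪ K₂)` lies in one finite cyclic group
  set U : Set ((thetaRayFreeProP p n).temperedPiChart h36).G :=
    (K₁ : Set ((thetaRayFreeProP p n).temperedPiChart h36).G) ∪
      (K₂ : Set ((thetaRayFreeProP p n).temperedPiChart h36).G) with hU
  have key : ∀ n₀, j₁ ≤ n₀ → ∃ ε : Dg.Gal hc n₀, IsOfFinOrder ε ∧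
      ∀ x ∈ U, Dg.proj hc n₀ x ∈ Subgroup.zpowers ε := by
    intro n₀ hn₀
    have hgne : Dg.proj hc n₀ g ≠ 1 := hj₁ n₀ hn₀
    -- level-`n₀` data: the core `G(d)` acting trivially, the far twists
    haveI : Finite (((Dg.S n₀).SV (0 : ℕ)).obj.V) := ((thetaRayFreeProP p n).galoisLevelData_isFinite h36 n₀).finite_V (0 : ℕ)
    set d : ℕ := Nat.card (((Dg.S n₀).SV (0 : ℕ)).obj.V) with hd
    have hV : ∀ (w : ℕ) (P : Dg.PointSeq hc w) (v : Grp p), v ∈ charOpenCore (Grp p) d → P.gal n₀ v = 1 := by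
      intro w P v hv
      haveI : Finite (((Dg.S n₀).SV w).obj.V) := ((thetaRayFreeProP p n).galoisLevelData_isFinite h36 n₀).finite_V w
      apply P.gal_eq_one_of_mem_charOpenCore n₀ v
      rw [thetaRay_card_SV_eq (G := Grp p) (E := Multiplicative ℤ_[p]) (up := α p) (low := fun k => θα p (n k))
        (Dg.S n₀) w]
      exact hv
    haveI : (charOpenCore (Grp p) d).Normal := FreeProPRankTwo.normal_charOpenCore p d
    obtain ⟨τ, hτ⟩ := FreeProPRankTwo.exists_forall_θ_mul_inv_mem p (charOpenCore (Grp p) d)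
      (FreeProPRankTwo.isOpen_charOpenCore p d)
    obtain ⟨k₁, hk₁⟩ : ∃ k₁ : ℕ, ∀ k, k₁ ≤ k → τ ≤ n k :=
      Filter.eventually_atTop.mp (Filter.tendsto_atTop.mp hn τ)
    have htwist : ∀ k, k₁ ≤ k → ∀ x : Grp p, θ p (n k) x * x⁻¹ ∈ charOpenCore (Grp p) d :=
      fun k hk x => hτ (n k) (hk₁ k hk) x
    -- the far branch order `p^{e₀}` at level `n₀`
    set F₀ : ℕ := Nc n₀ + 1 with hF₀
    obtain ⟨e₀, hfarord⟩ := hNc n₀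
    -- escape levels for the far threshold `F := max k₁ F₀`
    obtain ⟨jK, hjK⟩ := hesc₁ (max k₁ F₀)
    obtain ⟨jg, hjg⟩ := hescg (max k₁ F₀)
    -- INITIAL FRAMES of `K₁` at every deep level, at a far vertex
    have hframe0 : ∀ N', jK ≤ N' → ∃ (w₀ : ℕ) (Py : Dg.PointSeq hc w₀) (b₀ : ℕ × Bool)
        (hb₀ : SemiGraph.ray.abuts b₀ = some w₀), F₀ ≤ w₀ ∧
        ∀ k ∈ K₁, ∃ t : Multiplicative ℤ_[p], Dg.proj hc N' k = Py.gal N' ((thetaRayFreeProP p n).brHom b₀ w₀ hb₀ t) := by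
      intro N' hN'
      -- two `K₁`-fixed vertices of different heights at level `N'`
      obtain ⟨ya, hya⟩ := hfixV K₁ hK₁c N'
      obtain ⟨jB, hjB⟩ := hesc₁ (Nat.succ ((Dg.treeProj N').vertexMap ya))
      obtain ⟨yb', hyb'⟩ := hfixV K₁ hK₁c (max N' jB)
      set yb := (Dg.treeTrans (le_max_left N' jB)).vertexMap yb' with hyb_def
      obtain ⟨hyb, hybh⟩ := hprojfix K₁ (le_max_left N' jB) yb' hyb'
      have hab : ya ≠ yb := by
        intro h
        have h1 := hjB _ (le_max_right N' jB) yb' hyb'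
        rw [← hybh, ← hyb_def, ← h] at h1
        exact Nat.not_succ_le_self _ h1
      obtain ⟨β₀, hβ₀a, hβ₀fix⟩ := Dg.exists_branch_fixed_of_two_fixed_vertices hc
        (K₁ : Set ((thetaRayFreeProP p n).temperedPiChart h36).G) N' hab hya hyb
      obtain ⟨Py, b₀, hb₀, hfr⟩ := (thetaRayFreeProP p n).exists_coframe_of_forall_branchMap_eq h36
        (K₁ : Set ((thetaRayFreeProP p n).temperedPiChart h36).G) N' β₀ hβ₀a hβ₀fix
      exact ⟨_, Py, b₀, hb₀, le_trans (le_max_right k₁ F₀) (hjK N' hN' ya hya), hfr⟩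
    -- the ORDER DEFECT `m` of `ρ_{n₀}(g)`
    obtain ⟨a, ha1, hae, horder⟩ : ∃ a : ℕ, 1 ≤ a ∧ a ≤ e₀ ∧ orderOf (Dg.proj hc n₀ g) = p ^ a := by
      obtain ⟨w₀, Py, b₀, hb₀, hw₀, hfr⟩ := hframe0 (max jK n₀) (le_max_left _ _)
      obtain ⟨t, ht⟩ := hfr g hgK₁
      have hn₀N : n₀ ≤ max jK n₀ := le_max_right _ _
      have hproj : Dg.proj hc n₀ g = Py.gal n₀ ((thetaRayFreeProP p n).brHom b₀ w₀ hb₀ t) := by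
        rw [← Py.proj_decompHom, ← Dg.mapLE_proj hc hn₀N (Py.decompHom _), Py.proj_decompHom, ← ht,
          Dg.mapLE_proj]
      have hmem : Dg.proj hc n₀ g ∈
          Subgroup.zpowers (Py.gal n₀ ((thetaRayFreeProP p n).brHom b₀ w₀ hb₀ (ofAdd (1 : ℤ_[p])))) := by
        rw [hproj]
        have h1 := thetaRayFreeProP_gal_conj_brHom_mem_zpowers p n h36 Py n₀ b₀ hb₀ 1 _ _ t rfl rfl
        simpa only [one_mul, inv_one, mul_one] using h1
      have hdvd : orderOf (Dg.proj hc n₀ g) ∣ p ^ e₀ := by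
        rw [← hfarord w₀ hw₀ b₀ hb₀ Py]
        exact orderOf_dvd_of_mem_zpowers hmem
      obtain ⟨a, hae, ha⟩ := (Nat.dvd_prime_pow hp.out).mp hdvd
      refine ⟨a, ?_, hae, ha⟩
      by_contra h0
      push Not at h0
      have : a = 0 := by omega
      rw [this, pow_zero, orderOf_eq_one_iff] at ha
      exact hgne ha
    set m : ℕ := e₀ - a with hmdef
    have hm : m < e₀ := by omega
    have horder' : orderOf (Dg.proj hc n₀ g) = p ^ (e₀ - m) := by
      rw [horder]; congr 1; omega
    -- the frame-shift level for the shell `‖p^m‖ ≤ ‖λ‖`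
    have hΛ : IsCompact {l : Multiplicative ℤ_[p] | ‖(p : ℤ_[p]) ^ m‖ ≤ ‖l.toAdd‖} :=
      (isClosed_le continuous_const (continuous_norm.comp continuous_toAdd)).isCompact
    have hΛ1 : (1 : Multiplicative ℤ_[p]) ∉ {l : Multiplicative ℤ_[p] | ‖(p : ℤ_[p]) ^ m‖ ≤ ‖l.toAdd‖} := by
      simp only [Set.mem_setOf_eq, toAdd_one, norm_zero, not_le]
      exact norm_pos_iff.mpr (pow_ne_zero m (Nat.cast_ne_zero.mpr hp.out.ne_zero))
    obtain ⟨N₀, hN₀⟩ := thetaRayFreeProP_frame_shift p n hΛ hΛ1 (charOpenCore (Grp p) d)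
      (FreeProPRankTwo.isOpen_charOpenCore p d) h36
    -- (♦) at every deep level: `g`-fixed vertices project onto `K₁`-fixed vertices of `𝔾̃_{n₀}`
    set Nd : ℕ := max (max N₀ jg) (max jK n₀) with hNd
    have hdiamond : ∀ N' (hnN : n₀ ≤ N'), Nd ≤ N' → ∀ yy : (Dg.tree N').Vertex,
        (Dg.treeAct hc N' g).hom.vertexMap yy = yy →
        ∀ k ∈ K₁, (Dg.treeAct hc n₀ k).hom.vertexMap ((Dg.treeTrans hnN).vertexMap yy) =
          (Dg.treeTrans hnN).vertexMap yy := by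
      intro N' hnN hNd' yy hyy
      have hN₀' : N₀ ≤ N' := ((le_max_left _ _).trans (le_max_left _ _)).trans hNd'
      have hjg' : jg ≤ N' := ((le_max_right _ _).trans (le_max_left _ _)).trans hNd'
      have hjK' : jK ≤ N' := ((le_max_left _ _).trans (le_max_right _ _)).trans hNd'
      obtain ⟨w₀, Py, b₀, hb₀, hw₀, hfr⟩ := hframe0 N' hjK'
      obtain ⟨l₀, hl₀⟩ := hfr g hgK₁
      -- (I2) at `n₀` by projecting the level-`N'` frames
      have hI2 : ∀ k ∈ (K₁ : Set ((thetaRayFreeProP p n).temperedPiChart h36).G), ∃ u : Multiplicative ℤ_[p],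
          Dg.proj hc n₀ k = Py.gal n₀ ((thetaRayFreeProP p n).brHom b₀ w₀ hb₀ u) := by
        intro k hk
        obtain ⟨t, ht⟩ := hfr k hk
        refine ⟨t, ?_⟩
        rw [← Py.proj_decompHom, ← Dg.mapLE_proj hc hnN (Py.decompHom _), Py.proj_decompHom, ← ht,
          Dg.mapLE_proj]
      -- `‖p^m‖ ≤ ‖λ₀‖` by the order bookkeeping at `n₀`
      have hlnorm : ‖(p : ℤ_[p]) ^ m‖ ≤ ‖l₀.toAdd‖ := by
        obtain ⟨u, hu⟩ := hI2 g hgK₁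
        let φ : Multiplicative ℤ_[p] →* Dg.Gal hc n₀ :=
          ((Dg.proj hc n₀).comp Py.decompHom).comp ((thetaRayFreeProP p n).brHom b₀ w₀ hb₀).toMonoidHom
        have hφc : Continuous φ :=
          ((Dg.continuous_proj hc n₀).comp Py.continuous_decompHom).comp
            ((thetaRayFreeProP p n).brHom b₀ w₀ hb₀).continuous
        have hφz : ∀ t, φ t ∈ Subgroup.zpowers (φ (ofAdd 1)) := fun t =>
          mem_zpowers_map_of_dense (ofAdd (1 : ℤ_[p])) PadicInt.topologicalClosure_zpowers_ofAdd_one φ hφc t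
        have hφ1 : orderOf (φ (ofAdd 1)) = p ^ e₀ := hfarord w₀ hw₀ b₀ hb₀ Py
        -- the level-`n₀` frame value of `g` on `b₀` is `φ l₀`
        have hgl : Dg.proj hc n₀ g = φ l₀ := by
          change Dg.proj hc n₀ g = Dg.proj hc n₀ (Py.decompHom ((thetaRayFreeProP p n).brHom b₀ w₀ hb₀ l₀))
          rw [← Dg.mapLE_proj hc hnN (Py.decompHom _), Py.proj_decompHom, ← hl₀, Dg.mapLE_proj]
        exact PadicInt.norm_pow_le_norm_of_orderOf_eq p φ hφz hφ1 m hm l₀ (by rw [← hgl]; exact horder')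
      refine thetaRayFreeProP_deepFixed_proj_fixed_gen p n h36 g
        (K₁ : Set ((thetaRayFreeProP p n).temperedPiChart h36).G) m N' hnN e₀ hm horder' d hV k₁
        htwist F₀ hfarord
        (fun w P b₁ b₂ hb₁ hb₂ f₁ f₂ y₁ y₂ k k₂ hk₂ hy₁ hy₂ heq =>
          hN₀ N' hN₀' w P b₁ b₂ hb₁ hb₂ f₁ f₂ y₁ y₂ k k₂ hk₂ hy₁ hy₂ heq)
        (fun y hy => ⟨le_trans (le_max_left _ _) (hjg N' hjg' y hy), le_trans (le_max_right _ _) (hjg N' hjg' y hy)⟩)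
        Py b₀ hb₀ l₀ hlnorm hl₀ hI2 yy hyy
    -- two deep `K₂`-fixed vertices of different heights and their projections `w ≠ w'`
    set N₁ : ℕ := Nd with hN₁
    have hn₀N₁ : n₀ ≤ N₁ := (le_max_right _ _).trans (le_max_right _ _)
    obtain ⟨y₂, hy₂⟩ := hfixV K₂ hK₂c N₁
    set w := (Dg.treeTrans hn₀N₁).vertexMap y₂ with hw
    obtain ⟨jB, hjB⟩ := hesc₂ (Nat.succ ((Dg.treeProj n₀).vertexMap w))
    set N₂ : ℕ := max N₁ jB with hN₂
    have hn₀N₂ : n₀ ≤ N₂ := hn₀N₁.trans (le_max_left _ _)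
    obtain ⟨y₃, hy₃⟩ := hfixV K₂ hK₂c N₂
    set w' := (Dg.treeTrans hn₀N₂).vertexMap y₃ with hw'
    obtain ⟨hKw, hwh⟩ := hprojfix K₂ hn₀N₁ y₂ hy₂
    obtain ⟨hKw', hw'h⟩ := hprojfix K₂ hn₀N₂ y₃ hy₃
    have hww' : w ≠ w' := by
      intro h
      have h2 := hjB N₂ (le_max_right _ _) y₃ hy₃
      rw [← hw'h, ← hw', ← h] at h2
      exact Nat.not_succ_le_self _ h2
    -- `K₁` fixes `w` and `w'` by (♦) (`g ∈ K₂` fixes `y₂`, `y₃`)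
    have hK₁w : ∀ k ∈ K₁, (Dg.treeAct hc n₀ k).hom.vertexMap w = w :=
      hdiamond N₁ hn₀N₁ le_rfl y₂ (hy₂ g hgK₂)
    have hK₁w' : ∀ k ∈ K₁, (Dg.treeAct hc n₀ k).hom.vertexMap w' = w' :=
      hdiamond N₂ hn₀N₂ (le_max_left _ _) y₃ (hy₃ g hgK₂)
    -- the set `K₁ ∪ K₂` fixes both, hence a common fixed branch `β` at `w`
    have hUw : ∀ x ∈ U, (Dg.treeAct hc n₀ x).hom.vertexMap w = w := fun x hx => hx.elim (hK₁w x) (hKw x)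
    have hUw' : ∀ x ∈ U, (Dg.treeAct hc n₀ x).hom.vertexMap w' = w' := fun x hx => hx.elim (hK₁w' x) (hKw' x)
    obtain ⟨β, hβw, hβfix⟩ := Dg.exists_branch_fixed_of_two_fixed_vertices hc U n₀ hww' hUw hUw'
    -- cover coordinates and the SQUEEZE
    set β₀ := (Dg.treeIso hc n₀).inv.branchMap β with hβ₀
    have hβeq : β = (Dg.treeIso hc n₀).hom.branchMap β₀ := (Dg.treeIso_hom_branchMap_inv hc n₀ β).symm
    set b : ℕ × Bool := β₀.1.1 with hbdef
    set kk : ℕ := (Dg.treeProj n₀).vertexMap w with hkdef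
    have hb : (thetaRayFreeProP p n).graph.abuts b = some kk := by
      have h1 := (Dg.treeProj n₀).abuts_branchMap β w hβw
      rwa [hβeq, Dg.treeProj_branchMap_treeIso hc] at h1
    have hUfix : ∀ x ∈ U, (CovObj.orbitGraphMap (Dg.proj hc n₀ x).hom).branchMap β₀ = β₀ := by
      intro x hx
      have hfixβ : (Dg.treeAct hc n₀ x).hom.branchMap β = β := hβfix x hx
      rw [Dg.treeAct_apply hc, hβeq, Dg.galTreeAct_branchMap_treeIso hc] at hfixβ
      have h2 := congrArg (Dg.treeIso hc n₀).inv.branchMap hfixβ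
      rwa [Dg.treeIso_inv_branchMap_hom hc, Dg.treeIso_inv_branchMap_hom hc] at h2
    obtain ⟨yv, hyβ⟩ := (Dg.cover hc n₀).exists_eq_brOf b hb β₀ rfl
    rw [hyβ] at hUfix
    set ε := (Dg.cover hc n₀).ptHom (hcover n₀) (htrans n₀) yv
      ((thetaRayFreeProP p n).brHom b kk hb (ofAdd (1 : ℤ_[p]))) with hε
    have hmemZ : ∀ q : Aut (Dg.cover hc n₀),
        (CovObj.orbitGraphMap q.hom).branchMap ((Dg.cover hc n₀).brOf b hb yv) = (Dg.cover hc n₀).brOf b hb yv →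
        q ∈ Subgroup.zpowers ε := by
      intro q hq
      obtain ⟨σ, hσ⟩ := (Dg.cover hc n₀).exists_aut_fV_eq (hcover n₀) (htrans n₀) yv yv
      rw [← hσ] at hq
      obtain ⟨a', ha, rfl⟩ := Subgroup.mem_map.mp (((Dg.cover hc n₀).stab_brOf_iff (hcover n₀) (htrans n₀) yv σ q).mp hq)
      have hσ1 : σ = 1 := (Dg.cover hc n₀).aut_eq_of_fV_eq (hcover n₀) yv (by rw [hσ]; rfl)
      subst hσ1
      rw [(Dg.cover hc n₀).map_ptHom_branchSubgroup_eq_zpowers (hcover n₀) (htrans n₀) hb yv (ofAdd (1 : ℤ_[p]))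
        PadicInt.topologicalClosure_zpowers_ofAdd_one, ← hε] at ha
      simpa using ha
    -- `ε` has finite order (a power of `p`), read in `Gal_{n₀}`
    obtain ⟨Py, hPy, -⟩ := Dg.exists_pointSeq_pt_eq hc n₀ yv
    have h1 : Py.gal n₀ ((thetaRayFreeProP p n).brHom b kk hb (ofAdd (1 : ℤ_[p]))) = ε := by
      rw [hε, ← hPy]
      exact (Py.eq_gal n₀ _ _ ((Dg.cover hc n₀).ptHom_apply (hcover n₀) (htrans n₀) (Py.pt n₀) _)).symm
    obtain ⟨e, he⟩ := thetaRayFreeProP_exists_orderOf_gal_eq_pow p n h36 Py n₀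
      ((thetaRayFreeProP p n).brHom b kk hb (ofAdd (1 : ℤ_[p])))
    have hfo : IsOfFinOrder (Py.gal n₀ ((thetaRayFreeProP p n).brHom b kk hb (ofAdd (1 : ℤ_[p])))) :=
      orderOf_pos_iff.mp (he ▸ pow_pos hp.out.pos e)
    exact ⟨Py.gal n₀ ((thetaRayFreeProP p n).brHom b kk hb (ofAdd (1 : ℤ_[p]))), hfo,
      fun x hx => h1 ▸ hmemZ _ (hUfix x hx)⟩
  -- the closure of `K₁ ⊔ K₂` has finite level images, hence is compact
  set L : Subgroup ((thetaRayFreeProP p n).temperedPiChart h36).G := (K₁ ⊔ K₂).topologicalClosure with hL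
  have hLfin : ∀ n₀ : ℕ, (Dg.projAut hc n₀ '' (L : Set ((thetaRayFreeProP p n).temperedPiChart h36).G)).Finite := by
    -- at the levels `≥ j₁` (read in `Gal_{n₀}`)
    have hbig : ∀ n₀, j₁ ≤ n₀ →
        (Dg.proj hc n₀ '' (L : Set ((thetaRayFreeProP p n).temperedPiChart h36).G)).Finite := by
      intro n₀ hn₀
      obtain ⟨ε, hε, hmem⟩ := key n₀ hn₀
      have hsup : K₁ ⊔ K₂ ≤ (Subgroup.zpowers ε).comap (Dg.proj hc n₀) := by
        refine sup_le (fun x hx => ?_) (fun x hx => ?_)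
        · exact hmem x (Or.inl hx)
        · exact hmem x (Or.inr hx)
      have h1 : Dg.proj hc n₀ '' (L : Set ((thetaRayFreeProP p n).temperedPiChart h36).G) ⊆
          closure (Dg.proj hc n₀ '' ((K₁ ⊔ K₂ : Subgroup ((thetaRayFreeProP p n).temperedPiChart h36).G) :
            Set ((thetaRayFreeProP p n).temperedPiChart h36).G)) :=
        image_closure_subset_closure_image (Dg.continuous_proj hc n₀)
      rw [(isClosed_discrete _).closure_eq] at h1
      haveI : Finite (Subgroup.zpowers ε) := hε.finite_zpowers
      refine ((Set.toFinite (Subgroup.zpowers ε : Set (Dg.Gal hc n₀))).subset ?_).subset h1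
      rintro _ ⟨x, hx, rfl⟩
      exact hsup hx
    intro n₀
    change (Dg.proj hc n₀ '' (L : Set ((thetaRayFreeProP p n).temperedPiChart h36).G)).Finite
    have h := le_max_right n₀ j₁
    have hle := le_max_left n₀ j₁
    have heq : Dg.proj hc n₀ '' (L : Set ((thetaRayFreeProP p n).temperedPiChart h36).G) =
        Dg.mapLE hc hle '' (Dg.proj hc (max n₀ j₁) '' (L : Set ((thetaRayFreeProP p n).temperedPiChart h36).G)) := by
      rw [Set.image_image]
      refine Set.image_congr' fun x => ?_
      exact (Dg.mapLE_proj hc hle x).symm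
    rw [heq]
    exact (hbig _ h).image _
  have hLclosed : IsClosed (L : Set ((thetaRayFreeProP p n).temperedPiChart h36).G) :=
    Subgroup.isClosed_topologicalClosure _
  have hLc : IsCompact (L : Set ((thetaRayFreeProP p n).temperedPiChart h36).G) :=
    Dg.isCompact_of_isClosed_of_forall_finite_image hc _ hLclosed hLfin
  -- maximality: `K₁ = L = K₂`
  have hK₁L : K₁ ≤ L := le_sup_left.trans (Subgroup.le_topologicalClosure _)
  have hK₂L : K₂ ≤ L := le_sup_right.trans (Subgroup.le_topologicalClosure _)
  rw [← hK₁max L hLc hK₁L, ← hK₂max L hLc hK₂L]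

end ProfiniteSemiGraph

end Literature.AnabelianGeometry.SemiGraphs

end
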